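import Literature.MathematicalPhysics.QuantumFieldTheory.Balaban1983to89.B9B8KnitLegsStraight
import Literature.MathematicalPhysics.QuantumFieldTheory.Balaban1983to89.B9Thm31SiteCoerciveReg335Y

/-!
# `Balaban1983to89.B9B8KnitVsTaxicab` — def-Y's TAXICAB TRANSPORTERS READ ON `ℤ^{d+1}` AND THE COMPARISON OF THE TWO TRANSPORTER LETTERS of [B9] §3:
# at every corner pair `(c_s, z)`, `z ∈ s ∈ 𝔅`, `‖parKnitY U c_s z − parSymY U c_s z‖ ≤ 8(d+1)²·α₀·(L^{j(s)}/L^k)²` on the class (52) (junction J-B file 5b)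

statement-level skeleton of published theorems with citation tags; proofs where landed; nothing here is a claim about the
Yang–Mills mass gap

T. Bałaban, *Propagators for lattice gauge theories in a background field*, Commun. Math. Phys. **99** (1985) 389–434 [`Balaban1985BackgroundPropagators`,
"[B9]"]; T. Bałaban, *Averaging operations for lattice gauge theories*, Commun. Math. Phys. **98** (1985) 17–51 [`Balaban1985Averaging`, "[B7]"].

THE PRINT.  [B9] (3.19) p. 393: the averaging operators' transporters are *«defined by (52), (53) in [5]»* (the knit letter `parKnitY`, junction file 1);
(3.40) p. 397: *«Γ_{x,x′} denote a shortest contour connecting points x and x′»* (def-Y's taxicab letter `parSY` ∕ `parSymY` of record).  The two conventions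
differ; this file proves they differ by `O(1)α₀` uniformly in the block scale on [B7]'s class (52) — the cell's dictionary statement used by the coercivity
transfer (file 6); it is NOT a numbered display of [B9].

CITATION HEADER (lean-in-tree rule).  Cell `lit-balaban`, sub-row G-B9-LETTERS, junction J-B (lead RULINGS #3–#4) file 5b → seat `lit-balaban-p33` gen 91.
REUSED BY NAME: def-Y `parTaxiV`/`parFwdV`/`taxiRun`/`taxiLegV`/`parSY`/`parSymY` (`Node00.OpsYTransport`, `OpsYRecordV4`), junction files 1–5a2
(`liftCfg`, `parKnitY`, `parOfT_blkCornerY`, `compT_vs_fw`, `fw`), dag-w1's block coordinates (`B9Thm31SiteCoerciveReg335CubeY.coord_bounds_of_blkOf`,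
`B9Thm31SiteCoerciveReg335BlockY.two_mul_side_le_N0`), `B10Eq27TorusAxialLog.transl`.

WHAT THIS FILE PROVES (sorry-free; one definition with body — the taxicab direction list `taxiDirs`).
* §1 `taxiDirs v` (directions `0, …, d` in increasing order, `v_μ` times each), its displacement; ★ `parFwdV_transl` (a forward leg on the torus IS the
  straight-segment holonomy of the periodic lift), `iterate_shift_transl`, ★ `taxiLegV_transl` (one leg, forward by `t` steps when `2t ≤ N`), ★★ `taxiRun_transl`
  (the whole run), ★★ `parSY_blkCornerY_eq_hol` (def-Y's `parSY U c_s z = (liftCfg U)(fw (taxiDirs (z − c_s)))` at corner pairs) and `parSymY_blkCornerY_eq_hol`.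
* §2 ★★★ `norm_parKnitY_sub_parSymY_le`: `G` averaging-closed, `U` `G`-valued, Prop. 2's smallness, `pdev (liftCfg U) < α₀(L^k)⁻²` ⇒ at every corner pair
  `‖parKnitY U c_s z − parSymY U c_s z‖ ≤ 8·(d+1)²·α₀·((L^{j(s)})²·(L^k)⁻²) ≤ 8(d+1)²α₀` (file 5a2's `compT_vs_fw` at the taxicab contour).

HONEST SCOPE.  Dictionary + bookkeeping estimate; nothing of [B9] Thm 3.1 is proved or asserted; count-neutral; nothing continuum, nothing about OS axioms or
the mass gap.  No `sorry`, no `axiom`, no `instance`, no `notation`.  Seat `lit-balaban-p33` gen 91, 2026-08-28.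
-/

noncomputable section

namespace Literature.MathematicalPhysics.QuantumFieldTheory.Balaban1983to89.B9B8KnitVsTaxicab

open B7Prop1Explicit renaming Site → LSite
open B7Prop1Explicit (e e_apply hol disp seg hol_cons hol_nil hol_append disp_seg disp_flatMap sum_zsmul_e seg_natCast stepHol_true U1)
open B7Prop2Explicit (avgIter AvgClosed pdev C0 c2')
open Literature.MathematicalPhysics.QuantumLattice (blockMap blockBase)
open B8Eq119TwistedAxial (bgT)
open B10Eq27TorusAxialLog (transl transl_apply transl_add_e)
open B6GlobalChartV1 (PV boxEquiv)
open B6KLevelCensusIndexV1 (KIdx)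
open B6Geom246MultiLevelBox (blkOf blkOf_eq_iff_blk)
open B4Reflection242 (blk)
open B9B8CarrierDictionary (liftCfg liftCfg_apply)
open B9B8AveragingKernelZd (compT)
open B9B8AveragingJunction (parOfT parKnitY parOfT_blkCornerY blk_eq_blockMap blockMap_iterate boxEquiv_transl_of_mem)
open B9B8KnitLegsStraight (fw fw_nil fw_cons fw_append fw_replicate fw_flatMap disp_fw_apply compT_vs_fw)
open B9Thm31SiteCoerciveReg335CubeY (coord_bounds_of_blkOf)
open B9Thm31SiteCoerciveReg335BlockY (two_mul_side_le_N0)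
open Node00

variable {d ℓ : ℕ} {hd : 1 ≤ d + 1} {hL : Odd (ℓ + 1) ∧ 1 < ℓ + 1} {b₀ b₁ : ℝ}
variable {𝔸 : Type} [NormedRing 𝔸] [NormedAlgebra ℂ 𝔸] [CompleteSpace 𝔸]

/-! ## §1 The taxicab transporter of the torus read on `ℤ^{d+1}` -/

section Taxi

/-- the TAXICAB direction list to a site of the positive orthant: directions `0, 1, …, d` in this order, `v_μ` steps each (def-Y's `parTaxiV` order).
[cite: Balaban1985BackgroundPropagators, (3.40) p.397] -/
def taxiDirs {D : ℕ} (v : LSite D) : List (Fin D) := (List.finRange D).flatMap fun μ => List.replicate (v μ).toNat μ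

omit [NormedAlgebra ℂ 𝔸] [CompleteSpace 𝔸] in
/-- for `v ≥ 0` the taxicab contour ends at `v`. [cite: Balaban1985BackgroundPropagators, (3.40) p.397, bookkeeping] -/
theorem disp_fw_taxiDirs {D : ℕ} {v : LSite D} (hv : 0 ≤ v) : disp (fw (taxiDirs v)) = v := by
  rw [taxiDirs, fw_flatMap, disp_flatMap]
  have h : ∀ μ : Fin D, disp (fw (List.replicate (v μ).toNat μ)) = v μ • e μ := fun μ => by
    rw [fw_replicate, disp_seg, Int.toNat_of_nonneg (hv μ)]
  simp only [h]
  conv_rhs => rw [← sum_zsmul_e v]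
  rw [Fin.sum_univ_def]

variable (i : KIdx d ℓ hd hL b₀ b₁)

/-- ★ a FORWARD LEG on the torus is the straight-segment holonomy of the periodic lift: `parFwdV U μ n (0 + x) = (liftCfg U)(x; seg_μ n)`.
[cite: Balaban1985BackgroundPropagators, (3.3) p.391, dictionary] -/
theorem parFwdV_transl (U : CfgY 𝔸 i) (μ : Fin (d + 1)) :
    ∀ (n : ℕ) (x : LSite (d + 1)), parFwdV U μ n (transl (0 : Site (PV d ℓ i.m i.K hd hL) 0) x) = hol (liftCfg U) x (seg μ (n : ℤ))
  | 0, x => by simp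
  | n + 1, x => by
      rw [parFwdV_succ, ← transl_add_e, parFwdV_transl U μ n (x + e μ), seg_natCast, seg_natCast, List.replicate_succ, hol_cons, stepHol_true,
        B7Prop1Explicit.Letter.vec_true, liftCfg_apply]

omit [NormedAlgebra ℂ 𝔸] [CompleteSpace 𝔸] in
/-- `t` unit steps on the torus = translation by `t·e_μ` on the lift. [cite: Balaban1985BackgroundPropagators, (3.3) p.391, bookkeeping] -/
theorem iterate_shift_transl (μ : Fin (d + 1)) : ∀ (t : ℕ) (x : LSite (d + 1)),
    (fun y : Site (PV d ℓ i.m i.K hd hL) 0 => y.shift μ)^[t] (transl (0 : Site (PV d ℓ i.m i.K hd hL) 0) x) = transl 0 (x + (t : ℤ) • e μ)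
  | 0, x => by simp
  | t + 1, x => by
      rw [Function.iterate_succ_apply', iterate_shift_transl μ t x, ← transl_add_e, Nat.cast_succ, add_smul, one_smul, add_assoc]

/-- ★ ONE TAXICAB LEG towards `0 + z` from `0 + w` with `z_μ = w_μ + t`, `2t ≤ N` (forward is the shorter way round): `t` forward bonds.
[cite: Balaban1985BackgroundPropagators, (3.40) p.397 («a shortest contour»), (3.3) p.391] -/
theorem taxiLegV_transl (U : CfgY 𝔸 i) {z w : LSite (d + 1)} {μ : Fin (d + 1)} {t : ℕ} (ht : z μ = w μ + t)
    (h2 : 2 * t ≤ (PV d ℓ i.m i.K hd hL).sitesPerDir 0) (acc : 𝔸ˣ) :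
    taxiLegV U (transl (0 : Site (PV d ℓ i.m i.K hd hL) 0) z) (transl 0 w, acc) μ = (transl 0 (w + (t : ℤ) • e μ), acc * hol (liftCfg U) w (seg μ (t : ℤ))) := by
  have hN : NeZero ((PV d ℓ i.m i.K hd hL).sitesPerDir 0) := inferInstance
  have hN1 : 1 ≤ (PV d ℓ i.m i.K hd hL).sitesPerDir 0 := Nat.one_le_iff_ne_zero.2 hN.ne
  have htN : t < (PV d ℓ i.m i.K hd hL).sitesPerDir 0 := by omega
  have hdiff : transl (0 : Site (PV d ℓ i.m i.K hd hL) 0) z μ - transl (0 : Site (PV d ℓ i.m i.K hd hL) 0) w μ = (t : ZMod _) := by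
    rw [transl_apply, transl_apply, ht]; push_cast; ring
  have h1 : (transl (0 : Site (PV d ℓ i.m i.K hd hL) 0) z μ - transl (0 : Site (PV d ℓ i.m i.K hd hL) 0) w μ).val = t := by
    rw [hdiff, ZMod.val_natCast, Nat.mod_eq_of_lt htN]
  have h2' : (transl (0 : Site (PV d ℓ i.m i.K hd hL) 0) w μ - transl (0 : Site (PV d ℓ i.m i.K hd hL) 0) z μ).val ≥ t ∨ t = 0 := by
    by_cases ht0 : t = 0
    · exact Or.inr ht0
    · left
      have hne : ((t : ℕ) : ZMod ((PV d ℓ i.m i.K hd hL).sitesPerDir 0)) ≠ 0 := fun h0 => ht0 (by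
        have := congrArg ZMod.val h0
        rwa [ZMod.val_natCast, Nat.mod_eq_of_lt htN, ZMod.val_zero] at this)
      rw [← neg_sub, hdiff, ZMod.neg_val, if_neg hne, ZMod.val_natCast, Nat.mod_eq_of_lt htN]
      omega
  unfold taxiLegV
  rw [if_pos (by rw [h1]; rcases h2' with h | h <;> omega), h1, iterate_shift_transl i μ t w, parFwdV_transl]

/-- a run with one more leg (`foldl`; = `B9Thm311DeltaPrimeWitness.taxiRun_cons`, not imported here). [cite: Balaban1985BackgroundPropagators, (3.40) p.397, bookkeeping] -/
theorem taxiRun_cons' (U : CfgY 𝔸 i) (x' : Site (PV d ℓ i.m i.K hd hL) 0) (μ : Fin (d + 1)) (l : List (Fin (d + 1)))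
    (st : Site (PV d ℓ i.m i.K hd hL) 0 × 𝔸ˣ) : taxiRun U x' (μ :: l) st = taxiRun U x' l (taxiLegV U x' st μ) := rfl

/-- ★★ THE WHOLE RUN over distinct directions `l`, from `0 + w` towards `0 + z` with `z_μ = w_μ + v_μ`, `0 ≤ v_μ`, `2v_μ ≤ N` on `l`: the transporter
accumulates the holonomy of the lift along `fw (l.flatMap (μ ↦ v_μ copies of μ))`. [cite: Balaban1985BackgroundPropagators, (3.40) p.397, (3.3) p.391] -/
theorem taxiRun_transl (U : CfgY 𝔸 i) (z : LSite (d + 1)) :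
    ∀ (l : List (Fin (d + 1))), l.Nodup → ∀ (w : LSite (d + 1)) (acc : 𝔸ˣ),
      (∀ μ ∈ l, 0 ≤ z μ - w μ ∧ 2 * (z μ - w μ).toNat ≤ (PV d ℓ i.m i.K hd hL).sitesPerDir 0) →
      (taxiRun U (transl (0 : Site (PV d ℓ i.m i.K hd hL) 0) z) l (transl 0 w, acc)).2 =
        acc * hol (liftCfg U) w (fw (l.flatMap fun μ => List.replicate (z μ - w μ).toNat μ))
  | [], _, w, acc, _ => by simp [taxiRun, hol_nil]
  | μ :: l, hl, w, acc, h => by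
      have hμ := h μ (by simp)
      have hnd : μ ∉ l := (List.nodup_cons.1 hl).1
      set t : ℕ := (z μ - w μ).toNat with ht
      have hzt : z μ = w μ + t := by rw [ht, Int.toNat_of_nonneg hμ.1]; ring
      rw [taxiRun_cons', taxiLegV_transl i U hzt hμ.2 acc,
        taxiRun_transl U z l (List.nodup_cons.1 hl).2 (w + (t : ℤ) • e μ) _ (fun ν hν => ?_)]
      · have hrest : (l.flatMap fun ν => List.replicate (z ν - (w + (t : ℤ) • e μ) ν).toNat ν) = l.flatMap fun ν => List.replicate (z ν - w ν).toNat ν := by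
          refine List.flatMap_congr fun ν hν => ?_
          have hne : ν ≠ μ := fun h' => hnd (h' ▸ hν)
          simp [e_apply, hne]
        rw [hrest, List.flatMap_cons, fw_append, hol_append, fw_replicate, disp_seg, mul_assoc]
      · have hne : ν ≠ μ := fun h' => hnd (h' ▸ hν)
        have : (w + (t : ℤ) • e μ) ν = w ν := by simp [e_apply, hne]
        rw [this]; exact h ν (by simp [hν])

/-- the inverse chart of a box site is its translate from `0`. [cite: Balaban1985BackgroundPropagators, (3.1) p.390, dictionary] -/
theorem boxEquiv_symm_eq_transl (z : SiteY i) : (boxEquiv i.hN).symm z = transl (0 : Site (PV d ℓ i.m i.K hd hL) 0) z.1 := by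
  rw [Equiv.symm_apply_eq]; exact (boxEquiv_transl_of_mem i z.2).symm

/-- ★★ **def-Y's TAXICAB TRANSPORTER AT A CORNER PAIR, READ ON `ℤ^{d+1}`**: for `z ∈ s ∈ 𝔅` with corner `c_s`,
`parSY U c_s z = (liftCfg U)(c_s; fw (taxiDirs (z − c_s)))`. [cite: Balaban1985BackgroundPropagators, (3.40) p.397, (3.19) p.393, dictionary] -/
theorem parSY_blkCornerY_eq_hol (U : CfgY 𝔸 i) {z : SiteY i} {s : BlkY i} (h : blkOf i.D.toDomains z = s) :
    parSY i U (blkCornerY i s) z = hol (liftCfg U) (blkCornerY i s).1 (fw (taxiDirs (z.1 - (blkCornerY i s).1))) := by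
  show parTaxiV U ((boxEquiv i.hN).symm (blkCornerY i s)) ((boxEquiv i.hN).symm z) = _
  rw [boxEquiv_symm_eq_transl, boxEquiv_symm_eq_transl, parTaxiV]
  have hrun := taxiRun_transl i U z.1 (List.finRange (d + 1)) (List.nodup_finRange _) (blkCornerY i s).1 1 (fun μ _ => ?_)
  · rw [hrun, one_mul]; rfl
  · have hb := coord_bounds_of_blkOf i h μ
    refine ⟨by linarith [hb.1], ?_⟩
    have h2 := two_mul_side_le_N0 i s μ
    rw [i.hN μ] at h2
    have hn : ((((ℓ + 1) ^ s.1.1 : ℕ)) : ℤ) = ((ℓ : ℤ) + 1) ^ s.1.1 := by push_cast; ring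
    have : (z.1 μ - (blkCornerY i s).1 μ).toNat ≤ (ℓ + 1) ^ s.1.1 := by
      have h0 : 0 ≤ z.1 μ - (blkCornerY i s).1 μ := by linarith [hb.1]
      zify; rw [Int.toNat_of_nonneg h0]; linarith [hb.2, hn]
    omega

/-- the corner precedes every site of its block in def-Y's order, so `parSymY = parSY` there. [cite: Balaban1985BackgroundPropagators, (3.40) p.397, bookkeeping] -/
theorem parSymY_blkCornerY_eq_hol (U : CfgY 𝔸 i) {z : SiteY i} {s : BlkY i} (h : blkOf i.D.toDomains z = s) :
    parSymY i U (blkCornerY i s) z = hol (liftCfg U) (blkCornerY i s).1 (fw (taxiDirs (z.1 - (blkCornerY i s).1))) := by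
  rw [parSymY_of_le (Pi.toLex_monotone fun μ => (coord_bounds_of_blkOf i h μ).1)]
  exact parSY_blkCornerY_eq_hol i U h

end Taxi

/-! ## §2 The two transporter letters differ by `O(1)α₀` at corner pairs -/

section Compare

variable (i : KIdx d ℓ hd hL b₀ b₁) [NormOneClass 𝔸]

omit [NormOneClass 𝔸] in
/-- ★ THE KNIT LETTER AT A CORNER PAIR in file 5a2's normal form: `parKnitY U c_s z = compT L (bgT L (liftCfg U)) j ((blockMap L)^[j] z) z`, `j = j(s)`, and
`c_s = Lʲ·(blockMap L)^[j] z`. [cite: Balaban1985BackgroundPropagators, (3.19) p.393, bookkeeping] -/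
theorem parKnitY_blkCornerY_eq (U : CfgY 𝔸 i) {z : SiteY i} {s : BlkY i} (h : blkOf i.D.toDomains z = s) :
    parKnitY i U (blkCornerY i s) z = compT (ℓ + 1) (bgT (ℓ + 1) (liftCfg U)) s.1.1 ((blockMap (ℓ + 1))^[s.1.1] z.1) z.1 ∧
      (blkCornerY i s).1 = (((ℓ + 1) ^ s.1.1 : ℕ) : ℤ) • (blockMap (ℓ + 1))^[s.1.1] z.1 := by
  have hb : blk ((ℓ + 1) ^ s.1.1) z.1 = s.1.2 := (blkOf_eq_iff_blk i.D.toDomains).1 h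
  have hy : (blockMap (ℓ + 1))^[s.1.1] z.1 = s.1.2 := by rw [blockMap_iterate, ← blk_eq_blockMap, hb]
  refine ⟨?_, ?_⟩
  · rw [hy]; exact parOfT_blkCornerY i _ h
  · rw [hy, ← B9Thm311PositivityKnitLetter.blockBase_eq_smul]; rfl

/-- ★★★ **THE TWO TRANSPORTER LETTERS OF [B9] §3 DIFFER BY `O(1)α₀` AT EVERY CORNER PAIR**: `G` averaging-closed (`AvgClosed (d+1) (ℓ+1) G`), `U` `G`-valued,
`0 < α₀`, `C₀α₀ ≤ ⅓`, `2α₀ ≤ c₂′`, `pdev (liftCfg U) < α₀(L^k)⁻²` ([B7] (52) for the lift); then for `z ∈ s ∈ 𝔅`: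
`‖parKnitY U c_s z − parSymY U c_s z‖ ≤ 8·(d+1)²·α₀·((L^{j(s)})²·((L^k)⁻¹)²)`. [cite: Balaban1985BackgroundPropagators, (3.19) p.393, (3.40) p.397; Balaban1985Averaging, (52)–(53) pp.26–27, (44) p.24] -/
theorem norm_parKnitY_sub_parSymY_le (hd1 : 1 ≤ d + 1) {G : Subgroup 𝔸ˣ} (hG : AvgClosed (d + 1) (ℓ + 1) G) {U : CfgY 𝔸 i} (hU : ∀ μ x, U μ x ∈ G)
    {α₀ : ℝ} (hα : 0 < α₀) (hα3 : C0 (d + 1) * α₀ ≤ 1 / 3) (hα2 : 2 * α₀ ≤ c2' (d + 1) (ℓ + 1))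
    (h52 : pdev (liftCfg U) < α₀ * ((((ℓ : ℝ) + 1) ^ i.k)⁻¹) ^ 2) {z : SiteY i} {s : BlkY i} (h : blkOf i.D.toDomains z = s) :
    ‖(parKnitY i U (blkCornerY i s) z : 𝔸) - parSymY i U (blkCornerY i s) z‖ ≤
      8 * ((d : ℝ) + 1) ^ 2 * α₀ * ((((ℓ : ℝ) + 1) ^ s.1.1) ^ 2 * ((((ℓ : ℝ) + 1) ^ i.k)⁻¹) ^ 2) := by
  obtain ⟨hK, hc⟩ := parKnitY_blkCornerY_eq i U h
  have hV : ∀ x κ, liftCfg U x κ ∈ G := fun x κ => B9B8CarrierDictionary.liftCfg_mem hU x κ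
  have hjk : s.1.1 ≤ i.k := (B6Geom246MultiLevelBox.scale_bounds i.D.toDomains s).2
  have hv : 0 ≤ z.1 - (blkCornerY i s).1 := fun μ => by have := (coord_bounds_of_blkOf i h μ).1; simp only [Pi.sub_apply, Pi.zero_apply]; linarith
  have hA : disp (fw (taxiDirs (z.1 - (blkCornerY i s).1))) = z.1 - (((ℓ + 1) ^ s.1.1 : ℕ) : ℤ) • (blockMap (ℓ + 1))^[s.1.1] z.1 := by
    rw [disp_fw_taxiDirs hv, hc]
  have hmain := compT_vs_fw hd1 (ℓ + 1) hL.2 hG i.k hV hα hα3 hα2 (by push_cast; exact h52) hjk z.1 hA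
  rw [hK, parSymY_blkCornerY_eq_hol i U h]
  rw [← hc] at hmain
  push_cast at hmain
  exact hmain

end Compare

end Literature.MathematicalPhysics.QuantumFieldTheory.Balaban1983to89.B9B8KnitVsTaxicab

end
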